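import Summits.QuantumFields.YangMills.Theorems.ColdStartUniversalityLatticeLangevinLiebRobinsonCouplingLipschitz
import Literature.MathematicalPhysics.QuantumLattice.BalabanRGSpreadTwist
import HarnessLib

/-!
# Route `ColdStartUniversality` (fixed-cut-off SZZ dynamics; LIEB–ROBINSON / LOCALITY package, file 26):
# ★★ THE PLAQUETTE EXPECTATION IS `O(β')` UNIFORMLY IN THE VOLUME — leading strong-coupling behaviour, every `L ≥ 2`

Helper file (seat `ym-line-csu-p1`, g31; `--supports stmt-QuantumFields-24809`).  At `β' = 0` the Wilson measure is product Haar and the plaquette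
expectation vanishes (flip ONE link by the centre element `−1 ∈ SU(2)`: a measure-preserving map, `measurePreserving_update_mul_pi`, under which
`Re tr U_p ↦ −Re tr U_p` as soon as the four links of `p` are distinct, i.e. `L ≥ 2`); the volume-uniform Lipschitz continuity in the coupling
(`wilson_loop_expectation_lipschitz`, file 21) then gives:
* `wilsonMeasure_zero_eq_pi` — `μ_0 = Haar^⊗E`;  ★ `integral_plaquette_pi_eq_zero` — `∫ Re tr ρ(U_p) dHaar^⊗E = 0` (`1 < L`, `i ≠ j`);
* ★★ `abs_plaquette_expectation_le` — for `|β'| < 1/12`, `1 < L`, `i ≠ j`: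
  `|⟨Re tr U_p⟩_(μ_β')| ≤ 12·(16384π²/ρ)·√108·(1+12/κ)³/(1−e^(−κ/2))·|β'|`, `ρ = 1 − 12|β'|`, `κ = ρ log 108/(2(λ+ρ))` — the SAME constant for every `L`.
THEOREMS ONLY, no definition, no sorry; [folklore].  HONEST FRAMING: fixed cut-off, strong-coupling window, crude constant (the true slope is `O(1)`);
nothing about `β'_K → ∞`; `UniformColdStartMixing` (24809) is NOT restated; no crux, rung or summit statement is proved; the Yang–Mills mass gap is NOT proved.
-/

set_option autoImplicit false

noncomputable section

namespace Summit.QuantumFields.YangMills.Theorems.ColdStartUniversality.LiebRobinson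

open MeasureTheory ProbabilityTheory Matrix Complex Finset Filter Set Metric Function
open scoped ComplexConjugate BigOperators Matrix NNReal ENNReal Topology
open Literature.Probability.Process Literature.MathematicalPhysics.QuantumFieldTheory
open Literature.MathematicalPhysics.QuantumFieldTheory.Balaban1983to89
open Literature.MathematicalPhysics.QuantumLattice (fundamentalRep fundamentalLatticeRep continuous_fundamentalRep fundamentalRep_apply)

variable {L : ℕ} [NeZero L]

/-- `μ_0` is product Haar measure. [folklore] -/
theorem wilsonMeasure_zero_eq_pi (L : ℕ) [NeZero L] :
    (wilsonMeasure (d := 3) (L := L) (fundamentalRep (Fin 2)) 0) = (Measure.pi fun _ : Edge 3 L => haarProbability (Matrix.specialUnitaryGroup (Fin 2) ℂ)) := by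
  haveI := secondCountableTopology_su2
  haveI : IsProbabilityMeasure (Measure.pi fun _ : Edge 3 L => haarProbability (Matrix.specialUnitaryGroup (Fin 2) ℂ)) := inferInstance
  rw [Literature.MathematicalPhysics.QuantumLattice.wilsonMeasure_eq_tilted_pi (d := 3) (L := L) (fundamentalRep (Fin 2)) (continuous_fundamentalRep (Fin 2)) 0]
  have h0 : (fun U : GaugeConfig 3 L (Matrix.specialUnitaryGroup (Fin 2) ℂ) =>
      -(0 : ℝ) * Literature.MathematicalPhysics.QuantumFieldTheory.wilsonAction (fundamentalRep (Fin 2)) U) = fun _ => (0 : ℝ) := by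
    funext U; simp
  rw [h0, tilted_const]

/-- ★ **The plaquette has zero mean under product Haar** (`1 < L`, `i ≠ j`): flip the link `(x, i)` by the centre element `−1 ∈ SU(2)`
(measure preserving, `measurePreserving_update_mul_pi`); the other three links of the plaquette are distinct from `(x, i)`, so `Re tr ρ(U_p)` changes
sign. [folklore] -/
theorem integral_plaquette_pi_eq_zero (L : ℕ) [NeZero L] (hL : 1 < L) (x : Literature.MathematicalPhysics.QuantumFieldTheory.Site 3 L) {i j : Fin 3} (hij : i ≠ j) :
    ∫ U, ((fundamentalRep (Fin 2) (plaquetteHolonomy U x i j) : Matrix (Fin 2) (Fin 2) ℂ)).trace.re ∂(Measure.pi fun _ : Edge 3 L => haarProbability (Matrix.specialUnitaryGroup (Fin 2) ℂ)) = 0 := by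
  classical
  haveI := secondCountableTopology_su2
  haveI := borelSpace_config L
  haveI : Fact (1 < L) := ⟨hL⟩
  -- the centre element `c = −1`
  have hmem : (-1 : Matrix (Fin 2) (Fin 2) ℂ) ∈ Matrix.specialUnitaryGroup (Fin 2) ℂ := by
    rw [Matrix.mem_specialUnitaryGroup_iff]
    refine ⟨?_, ?_⟩
    · rw [Matrix.mem_unitaryGroup_iff]; simp
    · rw [Matrix.det_neg, Matrix.det_one]; simp
  let c : Matrix.specialUnitaryGroup (Fin 2) ℂ := ⟨-1, hmem⟩
  have hρc : (fundamentalRep (Fin 2) c : Matrix (Fin 2) (Fin 2) ℂ) = -1 := rfl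
  -- the flip of the link `(x, i)` preserves product Haar measure
  have hmp : MeasurePreserving (fun U : GaugeConfig 3 L (Matrix.specialUnitaryGroup (Fin 2) ℂ) => update U (x, i) (U (x, i) * c)) (Measure.pi fun _ : Edge 3 L => haarProbability (Matrix.specialUnitaryGroup (Fin 2) ℂ)) (Measure.pi fun _ : Edge 3 L => haarProbability (Matrix.specialUnitaryGroup (Fin 2) ℂ)) :=
    Literature.MathematicalPhysics.QuantumLattice.measurePreserving_update_mul_pi (G := Matrix.specialUnitaryGroup (Fin 2) ℂ)
      ((x, i) : Edge 3 L) (ψ := fun _ => c) measurable_const (fun _ _ => rfl)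
  -- distinctness of the other three links from `(x, i)`
  have hshift : Literature.MathematicalPhysics.QuantumFieldTheory.Site.shift x j ≠ x := by
    intro h
    have h1 : (Pi.single j (1 : ZMod L) : Fin 3 → ZMod L) = 0 := by
      have h' := congrArg (fun y => y - x) h
      simp only [Literature.MathematicalPhysics.QuantumFieldTheory.Site.shift, add_sub_cancel_left, sub_self] at h'
      exact h'
    have h2 := congrFun h1 j
    rw [Pi.single_eq_same, Pi.zero_apply] at h2
    exact one_ne_zero h2
  have hne1 : ((Literature.MathematicalPhysics.QuantumFieldTheory.Site.shift x i, j) : Edge 3 L) ≠ (x, i) := fun h => hij (congrArg Prod.snd h).symm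
  have hne2 : ((Literature.MathematicalPhysics.QuantumFieldTheory.Site.shift x j, i) : Edge 3 L) ≠ (x, i) := fun h => hshift (congrArg Prod.fst h)
  have hne3 : ((x, j) : Edge 3 L) ≠ (x, i) := fun h => hij (congrArg Prod.snd h).symm
  -- the sign flip of the plaquette trace
  have hflip : ∀ U : GaugeConfig 3 L (Matrix.specialUnitaryGroup (Fin 2) ℂ),
      ((fundamentalRep (Fin 2) (plaquetteHolonomy (update U (x, i) (U (x, i) * c)) x i j) : Matrix (Fin 2) (Fin 2) ℂ)).trace.re = -((fundamentalRep (Fin 2) (plaquetteHolonomy U x i j) : Matrix (Fin 2) (Fin 2) ℂ)).trace.re := by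
    intro U
    have h0 : update U (x, i) (U (x, i) * c) (x, i) = U (x, i) * c := update_self _ _ _
    have h1 : update U (x, i) (U (x, i) * c) (Literature.MathematicalPhysics.QuantumFieldTheory.Site.shift x i, j) = U (Literature.MathematicalPhysics.QuantumFieldTheory.Site.shift x i, j) := update_of_ne hne1 _ _
    have h2 : update U (x, i) (U (x, i) * c) (Literature.MathematicalPhysics.QuantumFieldTheory.Site.shift x j, i) = U (Literature.MathematicalPhysics.QuantumFieldTheory.Site.shift x j, i) := update_of_ne hne2 _ _
    have h3 : update U (x, i) (U (x, i) * c) (x, j) = U (x, j) := update_of_ne hne3 _ _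
    simp only [plaquetteHolonomy, h0, h1, h2, h3, map_mul, hρc, mul_neg, mul_one, neg_mul, Matrix.trace_neg, Complex.neg_re]
  -- integrate: `∫ f = ∫ f∘φ = −∫ f`
  have hhol : Continuous fun U : GaugeConfig 3 L (Matrix.specialUnitaryGroup (Fin 2) ℂ) => plaquetteHolonomy U x i j := by
    unfold plaquetteHolonomy
    fun_prop
  have hcont : Continuous fun U : GaugeConfig 3 L (Matrix.specialUnitaryGroup (Fin 2) ℂ) => ((fundamentalRep (Fin 2) (plaquetteHolonomy U x i j) : Matrix (Fin 2) (Fin 2) ℂ)).trace.re :=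
    Complex.continuous_re.comp ((continuous_subtype_val.comp hhol).matrix_trace)
  have hI := integral_map (μ := (Measure.pi fun _ : Edge 3 L => haarProbability (Matrix.specialUnitaryGroup (Fin 2) ℂ))) hmp.measurable.aemeasurable hcont.aestronglyMeasurable
  rw [hmp.map_eq] at hI
  have hneg : ∫ U, ((fundamentalRep (Fin 2) (plaquetteHolonomy (update U (x, i) (U (x, i) * c)) x i j) : Matrix (Fin 2) (Fin 2) ℂ)).trace.re ∂(Measure.pi fun _ : Edge 3 L => haarProbability (Matrix.specialUnitaryGroup (Fin 2) ℂ)) =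
      -∫ U, ((fundamentalRep (Fin 2) (plaquetteHolonomy U x i j) : Matrix (Fin 2) (Fin 2) ℂ)).trace.re ∂(Measure.pi fun _ : Edge 3 L => haarProbability (Matrix.specialUnitaryGroup (Fin 2) ℂ)) := by
    rw [← integral_neg]
    exact integral_congr_ae (ae_of_all _ hflip)
  linarith [hI.trans hneg]

/-- ★★ **THE PLAQUETTE EXPECTATION IS `O(β')` UNIFORMLY IN THE VOLUME.**  For `1 < L`, `i ≠ j` and `|β'| < 1/12`:
`|∫ Re tr ρ(U_p) dμ_(β')| ≤ 3·4·(1024π²·16/ρ)·√108·(1+12/κ)³/(1−e^(−κ/2))·|β'|`, `ρ = 1 − 12|β'|`, `κ = ρ log 108/(2((1300+4√2)|β'| + ρ))` — the same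
bound for every `L` (`wilson_loop_expectation_lipschitz` between `0` and `β'`, `integral_plaquette_pi_eq_zero`, `word_plaquette_eq`). [folklore] -/
theorem abs_plaquette_expectation_le (L : ℕ) [NeZero L] (hL : 1 < L) (β' : ℝ) (hβ : |β'| < 1 / 12) (x : Literature.MathematicalPhysics.QuantumFieldTheory.Site 3 L) {i j : Fin 3} (hij : i ≠ j) :
    |∫ U, ((fundamentalRep (Fin 2) (plaquetteHolonomy U x i j) : Matrix (Fin 2) (Fin 2) ℂ)).trace.re ∂(wilsonMeasure (d := 3) (L := L) (fundamentalRep (Fin 2)) β')| ≤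
      3 * (4 : ℝ) * ((1024 * Real.pi ^ 2 * (4 : ℝ) ^ 2) / (1 - 12 * |β'|) * Real.exp (Real.log 108 / 2) * ((1 + 12 / ((1 - 12 * |β'|) * Real.log 108 / (2 * ((1300 + 4 * Real.sqrt 2) * |β'| + (1 - 12 * |β'|))))) ^ 3 / (1 - Real.exp (-(((1 - 12 * |β'|) * Real.log 108 / (2 * ((1300 + 4 * Real.sqrt 2) * |β'| + (1 - 12 * |β'|)))) / 2))))) * |β'| := by
  classical
  have h0mem : (0 : ℝ) ∈ Set.Icc (-|β'|) |β'| := ⟨by simp [abs_nonneg], abs_nonneg _⟩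
  have hβmem : β' ∈ Set.Icc (-|β'|) |β'| := ⟨neg_abs_le _, le_abs_self _⟩
  have hlip : |(∫ U, (fun y : (Edge 3 L × Fin 2 × Fin 2 × Bool → ℝ) => (([((x, i), false), ((Literature.MathematicalPhysics.QuantumFieldTheory.Site.shift x i, j), false), ((Literature.MathematicalPhysics.QuantumFieldTheory.Site.shift x j, i), true), ((x, j), true)].map (fun a : Edge 3 L × Bool => if a.2 then ((fun (ee : Edge 3 L) => Matrix.of fun (i j : Fin 2) => ((y (ee, i, j, false) : ℝ) : ℂ) + ((y (ee, i, j, true) : ℝ) : ℂ) * Complex.I) a.1)ᴴ else (fun (ee : Edge 3 L) => Matrix.of fun (i j : Fin 2) => ((y (ee, i, j, false) : ℝ) : ℂ) + ((y (ee, i, j, true) : ℝ) : ℂ) * Complex.I) a.1)).prod).trace.re) (fun q : Edge 3 L × Fin 2 × Fin 2 × Bool => (fun z : ℂ => if q.2.2.2 then z.im else z.re) ((fundamentalRep (Fin 2) (U q.1) : Matrix (Fin 2) (Fin 2) ℂ) q.2.1 q.2.2.1)) ∂(wilsonMeasure (d := 3) (L := L) (fundamentalRep (Fin 2)) β')) 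-
      ∫ U, (fun y : (Edge 3 L × Fin 2 × Fin 2 × Bool → ℝ) => (([((x, i), false), ((Literature.MathematicalPhysics.QuantumFieldTheory.Site.shift x i, j), false), ((Literature.MathematicalPhysics.QuantumFieldTheory.Site.shift x j, i), true), ((x, j), true)].map (fun a : Edge 3 L × Bool => if a.2 then ((fun (ee : Edge 3 L) => Matrix.of fun (i j : Fin 2) => ((y (ee, i, j, false) : ℝ) : ℂ) + ((y (ee, i, j, true) : ℝ) : ℂ) * Complex.I) a.1)ᴴ else (fun (ee : Edge 3 L) => Matrix.of fun (i j : Fin 2) => ((y (ee, i, j, false) : ℝ) : ℂ) + ((y (ee, i, j, true) : ℝ) : ℂ) * Complex.I) a.1)).prod).trace.re) (fun q : Edge 3 L × Fin 2 × Fin 2 × Bool => (fun z : ℂ => if q.2.2.2 then z.im else z.re) ((fundamentalRep (Fin 2) (U q.1) : Matrix (Fin 2) (Fin 2) ℂ) q.2.1 q.2.2.1)) ∂(wilsonMeasure (d := 3) (L := L) (fundamentalRep (Fin 2)) 0)| ≤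
      3 * (([((x, i), false), ((Literature.MathematicalPhysics.QuantumFieldTheory.Site.shift x i, j), false), ((Literature.MathematicalPhysics.QuantumFieldTheory.Site.shift x j, i), true), ((x, j), true)] : List (Edge 3 L × Bool)).length : ℝ) * ((1024 * Real.pi ^ 2 * (([((x, i), false), ((Literature.MathematicalPhysics.QuantumFieldTheory.Site.shift x i, j), false), ((Literature.MathematicalPhysics.QuantumFieldTheory.Site.shift x j, i), true), ((x, j), true)] : List (Edge 3 L × Bool)).length : ℝ) ^ 2) / (1 - 12 * |β'|) * Real.exp (Real.log 108 / 2) * ((1 + 12 / ((1 - 12 * |β'|) * Real.log 108 / (2 * ((1300 + 4 * Real.sqrt 2) * |β'| + (1 - 12 * |β'|))))) ^ 3 / (1 - Real.exp (-(((1 - 12 * |β'|) * Real.log 108 / (2 * ((1300 + 4 * Real.sqrt 2) * |β'| + (1 - 12 * |β'|)))) / 2))))) * |β' - 0| :=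
    wilson_loop_expectation_lipschitz L β' hβ [((x, i), false), ((Literature.MathematicalPhysics.QuantumFieldTheory.Site.shift x i, j), false), ((Literature.MathematicalPhysics.QuantumFieldTheory.Site.shift x j, i), true), ((x, j), true)] (List.cons_ne_nil _ _) h0mem hβmem
  have hlen : (([((x, i), false), ((Literature.MathematicalPhysics.QuantumFieldTheory.Site.shift x i, j), false), ((Literature.MathematicalPhysics.QuantumFieldTheory.Site.shift x j, i), true), ((x, j), true)] : List (Edge 3 L × Bool)).length : ℝ) = 4 := by norm_num
  -- rewrite the word as the plaquette trace and evaluate at `β' = 0`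
  have hword : ∀ U : GaugeConfig 3 L (Matrix.specialUnitaryGroup (Fin 2) ℂ), (fun y : (Edge 3 L × Fin 2 × Fin 2 × Bool → ℝ) => (([((x, i), false), ((Literature.MathematicalPhysics.QuantumFieldTheory.Site.shift x i, j), false), ((Literature.MathematicalPhysics.QuantumFieldTheory.Site.shift x j, i), true), ((x, j), true)].map (fun a : Edge 3 L × Bool => if a.2 then ((fun (ee : Edge 3 L) => Matrix.of fun (i j : Fin 2) => ((y (ee, i, j, false) : ℝ) : ℂ) + ((y (ee, i, j, true) : ℝ) : ℂ) * Complex.I) a.1)ᴴ else (fun (ee : Edge 3 L) => Matrix.of fun (i j : Fin 2) => ((y (ee, i, j, false) : ℝ) : ℂ) + ((y (ee, i, j, true) : ℝ) : ℂ) * Complex.I) a.1)).prod).trace.re) (fun q : Edge 3 L × Fin 2 × Fin 2 × Bool => (fun z : ℂ => if q.2.2.2 then z.im else z.re) ((fundamentalRep (Fin 2) (U q.1) : Matrix (Fin 2) (Fin 2) ℂ) q.2.1 q.2.2.1)) = ((fundamentalRep (Fin 2) (plaquetteHolonomy U x i j) : Matrix (Fin 2) (Fin 2) ℂ)).trace.re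 :=
    fun U => word_plaquette_eq U x i j
  have e1 : (∫ U, (fun y : (Edge 3 L × Fin 2 × Fin 2 × Bool → ℝ) => (([((x, i), false), ((Literature.MathematicalPhysics.QuantumFieldTheory.Site.shift x i, j), false), ((Literature.MathematicalPhysics.QuantumFieldTheory.Site.shift x j, i), true), ((x, j), true)].map (fun a : Edge 3 L × Bool => if a.2 then ((fun (ee : Edge 3 L) => Matrix.of fun (i j : Fin 2) => ((y (ee, i, j, false) : ℝ) : ℂ) + ((y (ee, i, j, true) : ℝ) : ℂ) * Complex.I) a.1)ᴴ else (fun (ee : Edge 3 L) => Matrix.of fun (i j : Fin 2) => ((y (ee, i, j, false) : ℝ) : ℂ) + ((y (ee, i, j, true) : ℝ) : ℂ) * Complex.I) a.1)).prod).trace.re) (fun q : Edge 3 L × Fin 2 × Fin 2 × Bool => (fun z : ℂ => if q.2.2.2 then z.im else z.re) ((fundamentalRep (Fin 2) (U q.1) : Matrix (Fin 2) (Fin 2) ℂ) q.2.1 q.2.2.1)) ∂(wilsonMeasure (d := 3) (L := L) (fundamentalRep (Fin 2)) β')) =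
      ∫ U, ((fundamentalRep (Fin 2) (plaquetteHolonomy U x i j) : Matrix (Fin 2) (Fin 2) ℂ)).trace.re ∂(wilsonMeasure (d := 3) (L := L) (fundamentalRep (Fin 2)) β') := integral_congr_ae (ae_of_all _ hword)
  have e0 : (∫ U, (fun y : (Edge 3 L × Fin 2 × Fin 2 × Bool → ℝ) => (([((x, i), false), ((Literature.MathematicalPhysics.QuantumFieldTheory.Site.shift x i, j), false), ((Literature.MathematicalPhysics.QuantumFieldTheory.Site.shift x j, i), true), ((x, j), true)].map (fun a : Edge 3 L × Bool => if a.2 then ((fun (ee : Edge 3 L) => Matrix.of fun (i j : Fin 2) => ((y (ee, i, j, false) : ℝ) : ℂ) + ((y (ee, i, j, true) : ℝ) : ℂ) * Complex.I) a.1)ᴴ else (fun (ee : Edge 3 L) => Matrix.of fun (i j : Fin 2) => ((y (ee, i, j, false) : ℝ) : ℂ) + ((y (ee, i, j, true) : ℝ) : ℂ) * Complex.I) a.1)).prod).trace.re) (fun q : Edge 3 L × Fin 2 × Fin 2 × Bool => (fun z : ℂ => if q.2.2.2 then z.im else z.re) ((fundamentalRep (Fin 2) (U q.1) : Matrix (Fin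 2) (Fin 2) ℂ) q.2.1 q.2.2.1)) ∂(wilsonMeasure (d := 3) (L := L) (fundamentalRep (Fin 2)) 0)) = 0 := by
    rw [integral_congr_ae (ae_of_all _ hword), wilsonMeasure_zero_eq_pi L, integral_plaquette_pi_eq_zero L hL x hij]
  rw [e1, e0, sub_zero, sub_zero, hlen] at hlip
  exact hlip

end Summit.QuantumFields.YangMills.Theorems.ColdStartUniversality.LiebRobinson
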